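import Summits.BirchSwinnertonDyer.BirchSwinnertonDyer.Theorems.InertBadSignedBranchesInertBadAtThreeOddPrimeInstances
import HarnessLib

/-!
# The CLEAN odd currency ⟹ line `rubin_e1_inert_three`'s registered stub (v5) — the odd half of STUB-PLAN piece P0 (`stub_peel`)

Summit `BirchSwinnertonDyer`, crux `InertBadAtThree` (stmt-BirchSwinnertonDyer-19225), line of record `Lines/rubin_e1_inert_three.lean` v5
(lead `bsd-line-ibd-p1` g6), registered stub `stub_plainOddNeronIntegralThreeQuartic`. Ideator bsd-idea-18 g8's STUB-PLAN works in the CLEAN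
currency «`s · Σ_a χ(a){∞,a/ℓ}_f / (Ω⁻(V)·i)` is an algebraic integer for some `3 ∤ s`» (its `CleanNeronIntegralThreePolarAt`, odd branch) and
peels back to the stub's `(ϖ, r)` currency in piece P0. This file proves that peel for the ODD branch, which is all the v5 stub needs:

* `isIntegral_mul_varpi_mul_r_of_clean` — per instance: if `ϖ·Ω⁻(V) = Ω⁻_f` and `Σ_a χ(a){∞,a/m}_f = r·Ω⁻_f·i`, then `s·ϖ·r = s·Σ/(Ω⁻(V)·i)`
  (`Ω⁻(V) > 0`, `imaginaryPeriodRat_pos`), so clean integrality gives the stub's integrality;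
* **`plainOddQuartic_of_cleanOddQuartic`** — the v5 registered stub's statement (VERBATIM) from its CLEAN form «for every globally minimal `V`
  with `j = 1728` bad at `3`, conductor-level newform `f`, prime `ℓ ∤ N_V`, `ℓ ≡ 11 (mod 12)`, odd `χ` mod `ℓ` with `χ(3) ≠ 1`:
  `∃ s, 3 ∤ s ∧ IsIntegral ℤ (s · twistedSymbolSum f χ / (Ω⁻(V) · i))`» — so a seat that proves the clean form closes the stub by this lemma.

Nothing about BSD, the crux or the stub is proved here. No definitions; axioms standard.
-/

set_option autoImplicit false
set_option linter.dupNamespace false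

noncomputable section

open scoped Classical MatrixGroups ModularForm

open CongruenceSubgroup Complex WeierstrassCurve
  Literature.NumberTheory.EllipticCurves Literature.NumberTheory.EllipticCurves.ModularForms

namespace Summit.BirchSwinnertonDyer.BirchSwinnertonDyer.Theorems.InertBadSignedBranchesInertBadAtThreeCleanOddPeel

/-- **Per instance: clean odd integrality ⟹ the stub's `(ϖ, r)` integrality.** For an elliptic `V`, a cusp form `f` of any level, a
character `χ` mod `m`, `ϖ ∈ ℚ`, `r ∈ ℂ` with `ϖ·Ω⁻(V) = Ω⁻_f` and `Σ_a χ(a){∞,a/m}_f = r·Ω⁻_f·i`: `s·ϖ·r = s·Σ/(Ω⁻(V)·i)`, hence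
`IsIntegral ℤ (s·Σ/(Ω⁻(V)·i)) → IsIntegral ℤ (s·ϖ·r)` (`Ω⁻(V) > 0`). [folklore] -/
theorem isIntegral_mul_varpi_mul_r_of_clean (V : WeierstrassCurve ℚ) [V.IsElliptic] {N : ℕ}
    (f : CuspForm (Gamma0 N) 2) {m : ℕ} [NeZero m] (χ : DirichletCharacter ℂ m) {ϖ : ℚ} {r : ℂ} {s : ℕ}
    (hϖ : (ϖ : ℝ) * V.imaginaryPeriodRat = minusPeriod f)
    (hval : twistedSymbolSum f χ = r * (minusPeriod f : ℂ) * Complex.I)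
    (hclean : IsIntegral ℤ ((s : ℂ) * twistedSymbolSum f χ / ((V.imaginaryPeriodRat : ℂ) * Complex.I))) :
    IsIntegral ℤ ((s : ℂ) * ϖ * r) := by
  have hΩ : 0 < V.imaginaryPeriodRat := V.imaginaryPeriodRat_pos
  have hΩC : (V.imaginaryPeriodRat : ℂ) ≠ 0 := by exact_mod_cast hΩ.ne'
  have hden : (V.imaginaryPeriodRat : ℂ) * Complex.I ≠ 0 := mul_ne_zero hΩC I_ne_zero
  have hmin : (minusPeriod f : ℂ) = (ϖ : ℂ) * (V.imaginaryPeriodRat : ℂ) := by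
    rw [← hϖ]; push_cast; rfl
  have hkey : (s : ℂ) * twistedSymbolSum f χ / ((V.imaginaryPeriodRat : ℂ) * Complex.I) = (s : ℂ) * ϖ * r := by
    rw [hval, hmin]
    field_simp
  rw [← hkey]
  exact hclean

/-- **The v5 registered stub `stub_plainOddNeronIntegralThreeQuartic` (statement VERBATIM) from its CLEAN form** — the target the
STUB-PLAN's pieces P1–P6 actually compute (odd branch, quartic cell, conductor level, prime `ℓ ≡ 11 (mod 12)`, `χ(3) ≠ 1`).
[folklore] -/
theorem plainOddQuartic_of_cleanOddQuartic
    (hC : ∀ (V : WeierstrassCurve ℚ) [V.IsElliptic] [V.IsGloballyMinimal] [NeZero (V.conductorNorm ℤ)],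
      V.j = 1728 → ¬ V.HasGoodReductionAtPrime 3 →
      ∀ (f : CuspForm (CongruenceSubgroup.Gamma0 (V.conductorNorm ℤ)) 2),
        Literature.NumberTheory.EllipticCurves.ModularForms.IsNewformOf V f →
        ∀ (ℓ : ℕ) [NeZero ℓ], ℓ.Prime → ¬ ℓ ∣ V.conductorNorm ℤ → ℓ % 12 = 11 →
          ∀ χ : DirichletCharacter ℂ ℓ, χ.Odd → χ (3 : ZMod ℓ) ≠ 1 →
            ∃ s : ℕ, ¬ 3 ∣ s ∧
              IsIntegral ℤ ((s : ℂ) * Literature.NumberTheory.EllipticCurves.ModularForms.twistedSymbolSum f χ /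
                ((V.imaginaryPeriodRat : ℂ) * Complex.I))) :
    ∀ (V : WeierstrassCurve ℚ) [V.IsElliptic] [V.IsGloballyMinimal] [NeZero (V.conductorNorm ℤ)],
      V.j = 1728 → ¬ V.HasGoodReductionAtPrime 3 →
      ∀ (f : CuspForm (CongruenceSubgroup.Gamma0 (V.conductorNorm ℤ)) 2),
        Literature.NumberTheory.EllipticCurves.ModularForms.IsNewformOf V f →
        ∀ (ℓ : ℕ) [NeZero ℓ], ℓ.Prime → ¬ ℓ ∣ V.conductorNorm ℤ → ℓ % 12 = 11 →
          ∀ χ : DirichletCharacter ℂ ℓ, χ.Odd → χ (3 : ZMod ℓ) ≠ 1 →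
            ∀ (ϖ : ℚ) (r : ℂ),
              (ϖ : ℝ) * V.imaginaryPeriodRat = Literature.NumberTheory.EllipticCurves.ModularForms.minusPeriod f →
              Literature.NumberTheory.EllipticCurves.ModularForms.twistedSymbolSum f χ =
                r * (Literature.NumberTheory.EllipticCurves.ModularForms.minusPeriod f : ℂ) * Complex.I →
              ∃ s : ℕ, ¬ 3 ∣ s ∧ IsIntegral ℤ ((s : ℂ) * ϖ * r) := by
  intro V _ _ _ hj hbad f hf ℓ _ hℓ hℓN h12 χ hχ hχ3 ϖ r hϖ hval
  obtain ⟨s, hs, hclean⟩ := hC V hj hbad f hf ℓ hℓ hℓN h12 χ hχ hχ3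
  exact ⟨s, hs, isIntegral_mul_varpi_mul_r_of_clean V f χ hϖ hval hclean⟩

end Summit.BirchSwinnertonDyer.BirchSwinnertonDyer.Theorems.InertBadSignedBranchesInertBadAtThreeCleanOddPeel

end
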